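import Summits.QuantumFields.YangMills.Theorems.UnitScaleTiltProp7SectET3HessFormExplicitT3
import Summits.QuantumFields.YangMills.Theorems.UnitScaleTiltProp7SectET3DeltaOneT3JTerm
import Summits.QuantumFields.YangMills.Theorems.UnitScaleTiltProp7SectET3DeltaEtaExplicitT3
import Summits.QuantumFields.YangMills.Theorems.UnitScaleTiltProp7SectET3Objects
import Literature.MathematicalPhysics.QuantumFieldTheory.Balaban1983to89.B11Eq98CurrentSlot
import Literature.MathematicalPhysics.QuantumFieldTheory.Balaban1983to89.Node00.BackgroundCurrentCompare
import HarnessLib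

/-!
# Route `UnitScaleTilt`, crux «MinimiserStabilityRegPr» (stmt-QuantumFields-19200, stub EX `stub_existenceMinimalOrbit`, route (α)), node N06(d = 3) layer 0 —
# «ACTIONGRAD-JCUR»: **[Balaban1985BackgroundPropagators] (3.11) ∕ [Balaban1985Variational] (27) EXPLICIT AT THE T³ MEMBER — the first Fréchet derivative `actionGrad U₀` of
# the complexified Wilson action along the chart of record IS the pairing with the current `J = D*η⁻²Im ∂U₀`**, `actionGrad U₀ Z = −i·⟨formComp Z, J₁(U₀)⟩₍₃.₁₁₎`
# (route lattice `torusT`, background `bgUnits U₀`, `η = 1`), EXACT background, def-free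

Cell `ym3-torus` (HUMAN RULING D-0037, YM ladder rung R3 — YM₃ on T³, NOT d = 4, NOT Clay; YM gap NOT proved), width seat `ym3-torus-px21` gen 2 (explicit-unit helper;
lineage `hCrit93′`: ✓`Prop7Crit127OfCrit93Split`, ✓`Prop7Crit127Split127AtZero`, «CRIT93-OF-84» `Prop7Crit93OfEq111`).  THEOREMS ONLY (0 `def`, 0 `sorry`);
`--supports stmt-QuantumFields-19200 --as helper`, count-neutral; NO claim on crux ∕ stub ∕ registry.  The located row (iii) of ym-inputs-p01 g2's CLOSE (2026-08-28
13:56:54Z): «(3.11) explicit `actionGrad U₀ X = κ′·pair27 τ (Jcur …) X` (def-free)» — the J-half of the (84) junction that the EX row `hCrit93′` descends to.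

THE PRINT.  [Balaban1985BackgroundPropagators] p. 391 (3.7): «A^η(U′U₀) = A^η(U₀) + ⟨D^η_{U₀}A, η⁻² Im ∂U₀⟩ + ½⟨A, Δ^η(U₀)A⟩ + ⋯»; p. 392 (3.9) «The operator adjoint to derivative
D, acting on functions defined at bonds, is the operator acting on functions F defined at plaquettes …», (3.11) «⟨A, E⟩ = Σ_{b⊂T_η} η^d tr A(b)E(b) … J = D^{η*}(η⁻² Im ∂U)»,
(3.12) «A^η(exp iηA U) = A^η(U) + ⟨A, J⟩ + ½⟨A, ΔA⟩ + ⋯».  [Balaban1985Variational] (26)–(27) p. 282: «⟨A, J⟩ = Σ_b η^d tr A(b)J(b) (27)».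

HOW.  ★px5's ✓`Prop7SectET3ActionQuad.actionRe_chartU_smul_eq` expands `z ↦ actionRe (chartU U₀ (z•Z))` EXACTLY to second order with the linear coefficient
`𝔩(Z) = −i·Σ_p τ((D¹_{U₀}(formComp Z))(p)·Im U₀(∂p))`, `τ = ½tr`, and ✓`Prop7SectET3HessFormExplicit.actionRe_chartU_isBigO` gives the `O(‖z‖³)` remainder; §1's Taylor-coefficient
uniqueness at FIRST order (the sibling of ✓`iteratedDeriv_two_eq_of_isBigO_cube`) extracts `deriv … 0 = 𝔩(Z)`; the chain rule along `z ↦ z•Z` identifies that derivative with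
`actionGrad U₀ Z` (✓`Prop7SectET3DeltaOne.actionGrad_def`); lit ✓`B9Eq39Adjoint.bondPair_J` ((3.9) summed by parts, exact background) turns `Σ_p τ(curl·Im ∂U₀)` into the bond pairing
with `J`, after ✓`sum_plaq_eq_sum_posPlaq` (route plaquettes ↔ lit's `posPlaq`).

WHAT IS PROVED (member `F`, `K`; `U₀ : GaugeField (F.P K) 0 SU(2)`; `Z : PBond (F.P K) 0 → M₂(ℂ)` ANY exponent field; `τ := ½tr`; lit lattice `T := torusT (F.P K) 0`,
`U := fun μ x ↦ bgUnits F K U₀ ⟨x, μ⟩`; ns `…Theorems.Prop7ActionGradCurrent`):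
* §1 `deriv_eq_of_isBigO_cube` — if `g : ℂ → ℂ` is differentiable and `g z − (a + zb + z²c) = O(‖z‖³)` at `0` then `deriv g 0 = b` [folklore].
* §2 ★`deriv_actionRe_line_eq` (`∂_z actionRe (chartU U₀ (z•Z))|₀ = 𝔩(Z)`), ★`deriv_actionRe_line_eq_actionGrad` (`= actionGrad U₀ Z`, chain rule), ★★`actionGrad_apply_eq` (`actionGrad U₀ Z = 𝔩(Z)`
  in closed lattice letters — (3.7)'s linear term).
* §3 ★★★`actionGrad_eq_neg_I_mul_bondPair_J` — **(3.11)∕(27) AT THE MEMBER**: `actionGrad F K U₀ Z = −i · bondPair 1 (F.P K).d τ (formComp Z) (J T U 1)`, and ★★`actionGrad_eq_sum_bond`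
  (the same unfolded: `= −i · Σ_x Σ_μ τ(formComp Z μ x · J T U 1 μ x)`) — the current letter `B9Eq39Adjoint.J` on the ROUTE lattice at unit spacing.
* §4 the EX knit's letter: `imPart_smul_ofReal`; ★★`J_Tsh_bgOfCfg_eq` (lit's `J` on the `TSite` lattice at the background of record `bgOfCfg F K U₀` and spacing `η`, read at `siteEquiv x`,
  `= η⁻³ •` the route-lattice `J` at unit spacing — both are `Im (covDivT 1 …)`: ✓`Prop7SectET3Objects.divP_chart`, ✓`Node00.covDivT_eq_divPη`, ✓`B11Eq27Current.J_eq_imPart_div`);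
  `Jcur_bgOfCfg_apply` (S9's (111)-datum `Jcur (bgOfCfg F K U₀)` read at the route bond `b` is `η⁻³•J₁(b)`); ★★★`actionGrad_eq_inner_toL2_Jcur` — **(27) IN THE
  `L²` LETTERS OF THE EX DISPLAY**: `actionGrad F K U₀ Z = −(i·η³∕(2c₀)) · ⟪toL2 (Zᴴ), Ĵ⟫`, `Ĵ := funEquiv⁻¹(NegSup.equiv (Jcur (bgOfCfg F K U₀)))` = the `Ĵ` of ✓`toL2_iota_eq111` and of the
  (84)-row of ✓`Prop7Crit93OfEq111.deriv_eq_zero_of_eq111_of_h84` (for the knit's skew-Hermitian `δ`: `actionGrad U₀ δ = (i·η³∕(2c₀))·⟪toL2 δ, Ĵ⟫` — the J-third of that row with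
  its constant).
HONEST SCOPE.  Calculus + lit's exact summation by parts; the background is EXACT (no smallness, no unitarity); no estimate ((28) is ✓`B11Eq98CurrentSlot.norm_Jcur_le` elsewhere);
not a proof of any stub; nothing continuum ∕ OS ∕ mass-gap ∕ Clay.

References: T. Bałaban, CMP **99** (1985) 389–434 [Balaban1985BackgroundPropagators] ((3.7) p.391, (3.9)–(3.12) p.392); CMP **102** (1985) 277–309 [Balaban1985Variational]
((26)–(27) p.282, (84) p.290).
-/

set_option autoImplicit false

noncomputable section

open scoped Matrix.Norms.L2Operator BigOperators Topology InnerProductSpace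
open Complex (I)
open Asymptotics Filter

namespace Summit.QuantumFields.YangMills.Theorems.Prop7ActionGradCurrent

open Literature.MathematicalPhysics.QuantumFieldTheory.Balaban1983to89
open Literature.MathematicalPhysics.QuantumFieldTheory.Balaban1983to89.T3ContinuumYM3Torus
open T3SectALandauChart (formComp bgUnits)
open B9TorusCalculus (torusT)
open B9Eq37Insertion (reC imC)
open B9Eq39Adjoint (curl curlη lettersA plaqU bondPair bondPair_J)
open Beta.TransportVertices (commSum)
open Summit.QuantumFields.YangMills.Theorems.Prop7SectET3WilsonHessian (chartU actionRe contDiff_actionRe_chartU contDiff_actionRe_line)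
open Summit.QuantumFields.YangMills.Theorems.Prop7SectET3ActionQuad (halfTrace_comm)
open Summit.QuantumFields.YangMills.Theorems.Prop7SectET3HessFormExplicit (quadratic_coeff_eq_zero_of_isBigO actionRe_chartU_isBigO sum_plaq_eq_sum_posPlaq)
open Summit.QuantumFields.YangMills.Theorems.Prop7SectET3DeltaOne (actionGrad actionGrad_def)

/-! ## §1 Taylor-coefficient uniqueness at first order -/

/-- ★ **FIRST TAYLOR COEFFICIENT OF A DIFFERENTIABLE `g : ℂ → ℂ` FROM AN `O(‖z‖³)` EXPANSION**: if `g z − (a + zb + z²c) = O(‖z‖³)` at `0` then `deriv g 0 = b` (the power series of `g` at `0`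
has the same property, so its first coefficients are `a, b, c` — ✓`quadratic_coeff_eq_zero_of_isBigO` — and `deriv g 0 = p₁(1)` by `HasFPowerSeriesAt.deriv`). [folklore] -/
theorem deriv_eq_of_isBigO_cube {g : ℂ → ℂ} (hg : Differentiable ℂ g) {a b c : ℂ}
    (h : (fun z : ℂ => g z - (a + z * b + z ^ 2 * c)) =O[𝓝 (0 : ℂ)] (fun z : ℂ => ‖z‖ ^ 3)) :
    deriv g 0 = b := by
  obtain ⟨p, hp⟩ := hg.analyticAt 0
  obtain ⟨r, hpr⟩ := hp
  have hps := hpr.hasFPowerSeriesAt.isBigO_sub_partialSum_pow 3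
  have hpart : ∀ z : ℂ, p.partialSum 3 z = p.coeff 0 + z * p.coeff 1 + z ^ 2 * p.coeff 2 := by
    intro z
    simp only [FormalMultilinearSeries.partialSum, FormalMultilinearSeries.apply_eq_pow_smul_coeff, smul_eq_mul]
    simp [Finset.sum_range_succ]
  have h1 : (fun z : ℂ => g z - (p.coeff 0 + z * p.coeff 1 + z ^ 2 * p.coeff 2)) =O[𝓝 (0 : ℂ)] (fun z : ℂ => ‖z‖ ^ 3) := by
    refine hps.congr' (Eventually.of_forall fun z => ?_) EventuallyEq.rfl
    simp only [zero_add, hpart]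
  have hdiff : (fun z : ℂ => (a - p.coeff 0) + z * (b - p.coeff 1) + z ^ 2 * (c - p.coeff 2)) =O[𝓝 (0 : ℂ)] (fun z : ℂ => ‖z‖ ^ 3) := by
    refine (h1.sub h).congr' (Eventually.of_forall fun z => ?_) EventuallyEq.rfl
    simp only
    ring
  obtain ⟨-, hb, -⟩ := quadratic_coeff_eq_zero_of_isBigO hdiff
  have hb' : p.coeff 1 = b := by linear_combination -hb
  rw [hpr.hasFPowerSeriesAt.deriv, ← hb', FormalMultilinearSeries.apply_eq_pow_smul_coeff, one_pow, one_smul]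

/-! ## §2 The linear term of (3.7) along the chart IS `actionGrad` -/

variable {F : T3Family} {K : ℕ}

/-- ★ **`∂_z actionRe (chartU U₀ (z•Z))|_{z=0} = 𝔩(Z) := −i·Σ_p τ((D¹_{U₀}(formComp Z))(p)·Im U₀(∂p))`** — the linear coefficient of ★px5's exact expansion, extracted by §1.
[cite: Balaban1985BackgroundPropagators, (3.7) p.391, (3.12) p.392] -/
theorem deriv_actionRe_line_eq (U₀ : GaugeField (F.P K) 0 (Matrix.specialUnitaryGroup (Fin 2) ℂ)) (Z : PBond (F.P K) 0 → Matrix (Fin 2) (Fin 2) ℂ) :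
    deriv (fun z : ℂ => actionRe F K (chartU F K U₀ (z • Z))) 0
      = ∑ p : Plaq (F.P K) 0, -(I * (((2 : ℂ)⁻¹ • LinearMap.toContinuousLinearMap (Matrix.traceLinearMap (Fin 2) ℂ ℂ)) : Matrix (Fin 2) (Fin 2) ℂ →ₗ[ℂ] ℂ)
            (curl (torusT (F.P K) 0) (fun μ x => bgUnits F K U₀ ⟨x, μ⟩) (formComp Z) p.μ p.ν p.src
              * imC (plaqU (torusT (F.P K) 0) (fun μ x => bgUnits F K U₀ ⟨x, μ⟩) p.μ p.ν p.src))) := by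
  have hd : Differentiable ℂ (fun z : ℂ => actionRe F K (chartU F K U₀ (z • Z))) := (contDiff_actionRe_line U₀ Z).differentiable (by simp)
  exact deriv_eq_of_isBigO_cube hd (actionRe_chartU_isBigO U₀ Z)

/-- ★ **THE CHAIN RULE ALONG `z ↦ z•Z`: `∂_z actionRe (chartU U₀ (z•Z))|_{z=0} = actionGrad U₀ Z`.** [cite: Balaban1985BackgroundPropagators, (3.7) p.391, (3.12) p.392] -/
theorem deriv_actionRe_line_eq_actionGrad (U₀ : GaugeField (F.P K) 0 (Matrix.specialUnitaryGroup (Fin 2) ℂ)) (Z : PBond (F.P K) 0 → Matrix (Fin 2) (Fin 2) ℂ) :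
    deriv (fun z : ℂ => actionRe F K (chartU F K U₀ (z • Z))) 0 = actionGrad F K U₀ Z := by
  have hG : HasFDerivAt (fun X : PBond (F.P K) 0 → Matrix (Fin 2) (Fin 2) ℂ => actionRe F K (chartU F K U₀ X)) (actionGrad F K U₀) ((0 : ℂ) • Z) := by
    rw [zero_smul, actionGrad_def]
    exact (((contDiff_actionRe_chartU U₀).differentiable (by simp)) 0).hasFDerivAt
  have hl : HasDerivAt (fun z : ℂ => z • Z) Z 0 := by
    simpa using (hasDerivAt_id (0 : ℂ)).smul_const Z
  exact (hG.comp_hasDerivAt (0 : ℂ) hl).deriv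

/-- ★★ **(3.7)'s LINEAR TERM IN CLOSED LATTICE LETTERS: `actionGrad U₀ Z = −i·Σ_p τ((D¹_{U₀}(formComp Z))(p)·Im U₀(∂p))`**, EXACT background, ANY exponent field `Z`.
[cite: Balaban1985BackgroundPropagators, (3.7) p.391, (3.11)–(3.12) p.392] -/
theorem actionGrad_apply_eq (U₀ : GaugeField (F.P K) 0 (Matrix.specialUnitaryGroup (Fin 2) ℂ)) (Z : PBond (F.P K) 0 → Matrix (Fin 2) (Fin 2) ℂ) :
    actionGrad F K U₀ Z
      = ∑ p : Plaq (F.P K) 0, -(I * (((2 : ℂ)⁻¹ • LinearMap.toContinuousLinearMap (Matrix.traceLinearMap (Fin 2) ℂ ℂ)) : Matrix (Fin 2) (Fin 2) ℂ →ₗ[ℂ] ℂ)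
            (curl (torusT (F.P K) 0) (fun μ x => bgUnits F K U₀ ⟨x, μ⟩) (formComp Z) p.μ p.ν p.src
              * imC (plaqU (torusT (F.P K) 0) (fun μ x => bgUnits F K U₀ ⟨x, μ⟩) p.μ p.ν p.src))) := by
  rw [← deriv_actionRe_line_eq_actionGrad, deriv_actionRe_line_eq]

/-! ## §3 (3.11) ∕ (27): the linear term is the bond pairing with the current `J = D*Im ∂U₀` -/

/-- ★★★ **[Balaban1985BackgroundPropagators] (3.11) ∕ [Balaban1985Variational] (27) AT THE T³ MEMBER**: `actionGrad F K U₀ Z = −i · ⟨formComp Z, J(U₀)⟩`, the bond pairing `bondPair`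
((3.11), weight `η^d = 1`) of the exponent direction with lit's current `J T U 1 = D^{1*}(Im ∂U₀)` on the route lattice `T = torusT (F.P K) 0` at the background `U = bgUnits U₀` — (3.9)
summed by parts (✓`bondPair_J`), exact background. [cite: Balaban1985BackgroundPropagators, (3.9) p.392, (3.11) p.392; Balaban1985Variational, (27) p.282] -/
theorem actionGrad_eq_neg_I_mul_bondPair_J (U₀ : GaugeField (F.P K) 0 (Matrix.specialUnitaryGroup (Fin 2) ℂ)) (Z : PBond (F.P K) 0 → Matrix (Fin 2) (Fin 2) ℂ) :
    actionGrad F K U₀ Z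
      = -(I * bondPair 1 (F.P K).d
            (((2 : ℂ)⁻¹ • LinearMap.toContinuousLinearMap (Matrix.traceLinearMap (Fin 2) ℂ ℂ)) : Matrix (Fin 2) (Fin 2) ℂ →ₗ[ℂ] ℂ)
            (formComp Z) (B9Eq39Adjoint.J (torusT (F.P K) 0) (fun μ x => bgUnits F K U₀ ⟨x, μ⟩) 1)) := by
  rw [actionGrad_apply_eq, bondPair_J (torusT (F.P K) 0) (fun μ x => bgUnits F K U₀ ⟨x, μ⟩) _ halfTrace_comm 1 (F.P K).d (formComp Z)]
  rw [sum_plaq_eq_sum_posPlaq (fun x μ ν => -(I * (((2 : ℂ)⁻¹ • LinearMap.toContinuousLinearMap (Matrix.traceLinearMap (Fin 2) ℂ ℂ)) : Matrix (Fin 2) (Fin 2) ℂ →ₗ[ℂ] ℂ)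
      (curl (torusT (F.P K) 0) (fun μ x => bgUnits F K U₀ ⟨x, μ⟩) (formComp Z) μ ν x * imC (plaqU (torusT (F.P K) 0) (fun μ x => bgUnits F K U₀ ⟨x, μ⟩) μ ν x))))]
  simp only [Complex.ofReal_one, one_pow, one_mul, inv_one, one_smul, curlη, Finset.mul_sum, Finset.sum_neg_distrib]

/-- ★★ **THE SAME, UNFOLDED**: `actionGrad F K U₀ Z = −i · Σ_x Σ_μ τ((formComp Z) μ x · J(U₀) μ x)`. [cite: Balaban1985BackgroundPropagators, (3.11) p.392; Balaban1985Variational, (27) p.282] -/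
theorem actionGrad_eq_sum_bond (U₀ : GaugeField (F.P K) 0 (Matrix.specialUnitaryGroup (Fin 2) ℂ)) (Z : PBond (F.P K) 0 → Matrix (Fin 2) (Fin 2) ℂ) :
    actionGrad F K U₀ Z
      = -(I * ∑ x : Site (F.P K) 0, ∑ μ : Fin (F.P K).d, (((2 : ℂ)⁻¹ • LinearMap.toContinuousLinearMap (Matrix.traceLinearMap (Fin 2) ℂ ℂ)) : Matrix (Fin 2) (Fin 2) ℂ →ₗ[ℂ] ℂ)
            (formComp Z μ x * B9Eq39Adjoint.J (torusT (F.P K) 0) (fun μ x => bgUnits F K U₀ ⟨x, μ⟩) 1 μ x)) := by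
  rw [actionGrad_eq_neg_I_mul_bondPair_J]
  simp only [bondPair, Complex.ofReal_one, one_pow, one_mul]

/-! ## §4 The knit's letter `Jcur (bgOfCfg F K U₀)` IS this current, and (27) in the `L²` letters of the EX display -/

section Knit

open B11Eq90V0primeCurrent (Tsh Ucur)
open B11Eq27Current (plaqField imPart J_eq_imPart_div)
open B11Eq98CurrentSlot (Jcur)
open B11Eq115Space (NegSize NegSup)
open B11Eq103H1Complex (BondL2K funEquiv funEquiv_symm_apply)
open B9Eq311L2Pairing (WL2)
open B9SectCLatticeCarrier (Bond)
open B9Eq39Adjoint (divP divPη)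
open B10Eq27TorusAxialLog (unitsField toUField)
open B10Eq68TorusRegularity (covDivT)
open Summit.QuantumFields.YangMills.Theorems.Prop7SectET3Transport (periodsT3 siteEquiv siteEquiv_shiftEquiv bondEquiv bgOfCfg bgOfCfg_eq)
open Summit.QuantumFields.YangMills.Theorems.Prop7SectET3HilbertLetters (W₂ frobEquiv toL2 toL2_apply inner_toL2)
open Summit.QuantumFields.YangMills.Theorems.Prop7SectET3Objects (divP_chart)
open Summit.QuantumFields.YangMills.Theorems.Prop7SectET3DeltaEtaExplicit (val_inv_bgUnits_eq_star sum_pbond_eq)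
open Literature.MathematicalPhysics.QuantumFieldTheory.Balaban1983to89.Node00 (covDivT_eq_divPη)

variable {n : ℕ} {c₀ : ℝ}

/-- `Im (r•X) = r•Im X` for a REAL scalar. [folklore] -/
theorem imPart_smul_ofReal (r : ℝ) (X : Matrix (Fin 2) (Fin 2) ℂ) : imPart ((r : ℂ) • X) = (r : ℂ) • imPart X := by
  rw [imPart, imPart, star_smul, Complex.star_def, Complex.conj_ofReal, ← smul_sub, smul_comm]

/-- ★★ **THE TWO LATTICE READINGS OF THE CURRENT AGREE**: lit's `J` on the `TSite` lattice at the background of record `bgOfCfg F K U₀` and spacing `η`, read at `siteEquiv x`, is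
`η⁻³·` lit's `J` on the route lattice `torusT` at `bgUnits U₀` and unit spacing (both are `Im` of the route's divergence `covDivT 1`: ✓`divP_chart`, ✓`covDivT_eq_divPη`, ✓`J_eq_imPart_div`).
[cite: Balaban1985BackgroundPropagators, (3.8)–(3.9) p.392, (3.11) p.392; Balaban1985RegularSpaces, (1.1)–(1.2) p.76] -/
theorem J_Tsh_bgOfCfg_eq (U₀ : GaugeField (F.P K) 0 (Matrix.specialUnitaryGroup (Fin 2) ℂ)) (η : ℝ) (μ : Fin (F.P K).d) (x : Site (F.P K) 0) :
    B9Eq39Adjoint.J Tsh (Ucur (bgOfCfg F K U₀)) η μ (siteEquiv F K x)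
      = (((η : ℂ)⁻¹) ^ 3) • B9Eq39Adjoint.J (torusT (F.P K) 0) (fun μ x => bgUnits F K U₀ ⟨x, μ⟩) 1 μ x := by
  have hU : ∀ (κ : Fin 3) (y : B4Sect5Torus.TSite 3 (periodsT3 F K)),
      (((Ucur (bgOfCfg F K U₀) κ y)⁻¹ : (Matrix (Fin 2) (Fin 2) ℂ)ˣ) : Matrix (Fin 2) (Fin 2) ℂ) = star (Ucur (bgOfCfg F K U₀) κ y : Matrix (Fin 2) (Fin 2) ℂ) :=
    fun κ y => val_inv_bgUnits_eq_star U₀ κ ((siteEquiv F K).symm y)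
  have hU1 : ∀ (κ : Fin (F.P K).d) (y : Site (F.P K) 0),
      ((((fun μ x => bgUnits F K U₀ ⟨x, μ⟩) κ y)⁻¹ : (Matrix (Fin 2) (Fin 2) ℂ)ˣ) : Matrix (Fin 2) (Fin 2) ℂ) = star ((fun μ x => bgUnits F K U₀ ⟨x, μ⟩) κ y : Matrix (Fin 2) (Fin 2) ℂ) :=
    val_inv_bgUnits_eq_star U₀
  have hchart : divP Tsh (Ucur (bgOfCfg F K U₀)) (plaqField Tsh (Ucur (bgOfCfg F K U₀))) μ (siteEquiv F K x) = covDivT 1 (unitsField (toUField U₀)) μ x :=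
    divP_chart (siteEquiv F K) (fun x μ => siteEquiv_shiftEquiv F K x μ) U₀ μ x
  have htorus : divP (torusT (F.P K) 0) (fun μ x => bgUnits F K U₀ ⟨x, μ⟩) (plaqField (torusT (F.P K) 0) (fun μ x => bgUnits F K U₀ ⟨x, μ⟩)) μ x
      = covDivT 1 (unitsField (toUField U₀)) μ x := by
    have h1 := covDivT_eq_divPη 1 (bgUnits F K U₀) μ x
    rw [divPη, Complex.ofReal_one, inv_one, one_smul] at h1
    exact h1.symm
  have hL : B9Eq39Adjoint.J Tsh (Ucur (bgOfCfg F K U₀)) η μ (siteEquiv F K x)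
      = (((η : ℂ)⁻¹) ^ 2) • imPart (((η : ℂ)⁻¹) • covDivT 1 (unitsField (toUField U₀)) μ x) := by
    have h := J_eq_imPart_div Tsh (Ucur (bgOfCfg F K U₀)) hU η μ (siteEquiv F K x)
    rw [divPη, hchart] at h
    exact h
  have hR : B9Eq39Adjoint.J (torusT (F.P K) 0) (fun μ x => bgUnits F K U₀ ⟨x, μ⟩) 1 μ x = imPart (covDivT 1 (unitsField (toUField U₀)) μ x) := by
    have h := J_eq_imPart_div (torusT (F.P K) 0) (fun μ x => bgUnits F K U₀ ⟨x, μ⟩) hU1 1 μ x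
    rw [divPη, htorus, Complex.ofReal_one, inv_one, one_pow, one_smul, one_smul] at h
    exact h
  rw [hL, hR, ← Complex.ofReal_inv, imPart_smul_ofReal, smul_smul, ← pow_succ]

/-- **THE KNIT'S LETTER UNFOLDED**: the (−3)-datum `Jcur (bgOfCfg F K U₀)` of S9's (111) text, read at the route bond `b`, is `η⁻³·J₁(b)` with `J₁` the unit-spacing current on the route lattice.
[cite: Balaban1985Variational, (27)–(28) p.282, (111) p.294] -/
theorem Jcur_bgOfCfg_apply [Fact (0 < (F.L : ℝ))] [Fact (0 < ((F.L : ℝ)⁻¹) ^ (K - n))] (U₀ : GaugeField (F.P K) 0 (Matrix.specialUnitaryGroup (Fin 2) ℂ))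
    (b : PBond (F.P K) 0) :
    NegSup.equiv _ _ (Jcur (bgOfCfg F K U₀) : NegSize (F.L : ℝ) (((F.L : ℝ)⁻¹) ^ (K - n)) (fun _ : Bond 3 (periodsT3 F K) => K - n) 3 (Matrix (Fin 2) (Fin 2) ℂ))
        (bondEquiv F K b)
      = (((((F.L : ℝ)⁻¹) ^ (K - n) : ℝ) : ℂ)⁻¹ ^ 3) • B9Eq39Adjoint.J (torusT (F.P K) 0) (fun μ x => bgUnits F K U₀ ⟨x, μ⟩) 1 b.dir b.src := by
  rw [← J_Tsh_bgOfCfg_eq]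
  rfl

/-- ★★★ **[Balaban1985Variational] (27) IN THE `L²` LETTERS OF THE EX DISPLAY**: for ANY exponent field `Z`,
`actionGrad F K U₀ Z = −(i·η³∕(2c₀)) · ⟪toL2 (Zᴴ), Ĵ⟫` with `Ĵ := funEquiv⁻¹(NegSup.equiv (Jcur (bgOfCfg F K U₀)))` — the `Ĵ` of ✓`Prop7HessRowOfEq111.toL2_iota_eq111` and of the
(84)-row of ✓`Prop7Crit93OfEq111.deriv_eq_zero_of_eq111_of_h84` (for the knit's skew-Hermitian directions `δ`, `δᴴ = −δ`, this is `actionGrad U₀ δ = (i·η³∕(2c₀))·⟪toL2 δ, Ĵ⟫`).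
[cite: Balaban1985Variational, (27) p.282, (84) p.290; Balaban1985BackgroundPropagators, (3.11) p.392] -/
theorem actionGrad_eq_inner_toL2_Jcur [Fact (0 < c₀)] [Fact (0 < (F.L : ℝ))] [Fact (0 < ((F.L : ℝ)⁻¹) ^ (K - n))]
    (U₀ : GaugeField (F.P K) 0 (Matrix.specialUnitaryGroup (Fin 2) ℂ)) (Z : PBond (F.P K) 0 → Matrix (Fin 2) (Fin 2) ℂ) :
    actionGrad F K U₀ Z
      = -(I * ((((F.L : ℝ)⁻¹) ^ (K - n) : ℝ) : ℂ) ^ 3 / (2 * (c₀ : ℂ))) *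
          ⟪toL2 F K c₀ (star Z),
            (funEquiv frobEquiv (fun _ : Bond 3 (periodsT3 F K) => c₀)).symm
              (NegSup.equiv _ _ (Jcur (bgOfCfg F K U₀) : NegSize (F.L : ℝ) (((F.L : ℝ)⁻¹) ^ (K - n)) (fun _ : Bond 3 (periodsT3 F K) => K - n) 3 (Matrix (Fin 2) (Fin 2) ℂ)))⟫_ℂ := by
  have hη : ((((F.L : ℝ)⁻¹) ^ (K - n) : ℝ) : ℂ) ≠ 0 := Complex.ofReal_ne_zero.2 (Fact.out : 0 < ((F.L : ℝ)⁻¹) ^ (K - n)).ne'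
  have hc : (c₀ : ℂ) ≠ 0 := Complex.ofReal_ne_zero.2 (Fact.out : 0 < c₀).ne'
  -- `funEquiv⁻¹ g = toL2 (g ∘ bondEquiv)` (= ✓`Prop7Crit93OfEq111.funEquiv_symm_eq_toL2'`, inlined to keep this file import-light)
  have hfun : ∀ g : Bond 3 (periodsT3 F K) → Matrix (Fin 2) (Fin 2) ℂ,
      (funEquiv frobEquiv (fun _ : Bond 3 (periodsT3 F K) => c₀)).symm g = toL2 F K c₀ (fun b : PBond (F.P K) 0 => g (bondEquiv F K b)) := by
    intro g
    apply (WL2.equiv ℂ (fun _ : Bond 3 (periodsT3 F K) => c₀) W₂).injective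
    funext p
    rw [funEquiv_symm_apply, toL2_apply, Equiv.apply_symm_apply]
  rw [hfun, inner_toL2, actionGrad_eq_sum_bond, sum_pbond_eq]
  simp only [Jcur_bgOfCfg_apply, Pi.star_apply, Matrix.star_eq_conjTranspose, Matrix.conjTranspose_conjTranspose, Matrix.mul_smul, Matrix.trace_smul,
    smul_eq_mul, Prop7SectET3ActionQuad.halfTrace_apply', ← Finset.mul_sum]
  simp only [formComp]
  have hη' : (((1 / (F.L : ℝ)) ^ (K - n) : ℝ) : ℂ) ≠ 0 := by rw [one_div]; exact hη
  field_simp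

end Knit

end Summit.QuantumFields.YangMills.Theorems.Prop7ActionGradCurrent

end
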